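import Literature.Analysis.FluidPDE.SelfSimilarEulerProfileVorticity
import HarnessLib

/-!
# Self-similar Euler profiles with power-law far field (the route class `𝓔_γ`), the
# `γ = ½` (Leray-scaling) clauses, and the Bernoulli form (3.29) of the profile equation

Analysis/FluidPDE definition file, second request `defn-IsSelfSimilarEulerProfile-2` (route
`NavierStokesRegularity/AffineBernoulli`, items `EulerLerayLiouville`, `AlignedStratumTrivial`,
`AxisymEulerLerayLiouville`, `AffineBernoulliIdentities`, …; route `VortexLineClock`, items
`TypeIIWindowCore` / `EmptyEulerWindow`), completing the vocabulary of
`SelfSimilarEulerProfile.lean` (first request; Constantin–Ignatova–Vicol, arXiv:2602.17570, §3):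
there `IsSelfSimilarEulerProfile γ c U P` is the stationary self-similar Euler system (3.3) alone
(`U ∈ C²`, `P ∈ C¹`, `(1−γ)U + ((γ(y−c) + U)·∇)U + ∇P = 0`, `div U = 0`), the far field (3.8) is
the separate predicate `HasSelfSimilarFarFieldWith`, `selfSimilarTransport γ c U = V = γ(y−c) + U`
is the total transport velocity (3.19) and `selfSimilarBernoulli γ c U P = ℋ` the self-similar
Bernoulli function (3.30), with the transport identity (3.31) `V·∇ℋ = (2γ−1)|V|²` proved.

## Contents

* `IsDecayingSelfSimilarEulerProfile γ c U P` — **the class the routes quantify over**, verbatim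
  the conjunction they inline: `U ∈ C²`, `P ∈ C¹`, `div U = 0`, the profile equation (3.3) with
  exponent `γ` and centre `c`, and the power-law far field
  `|U(y)| ≤ C (1+|y|)^{1−1/γ}`, `‖DU(y)‖ ≤ C (1+|y|)^{−1/γ}` for some `C` — the rates of CIV (3.8)
  (`|U| ∼ |y|^{(γ−1)/γ}`, `|∇U| ∼ |y|^{−1/γ}`, §3.1.3) in the bracket `1 + |y|`, real powers.
  This is the profile class of the self-similar ansatz (3.2)
  `u(x,t) = (T−t)^{γ−1} U((x − x_*)/(T−t)^γ)` (Chae–Shvydkoy, §1, write the same ansatz as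
  `u = (T−t)^{−α/(1+α)} v((x−x^*)/(T−t)^{1/(1+α)})`, so `γ = 1/(1+α)`, and record for `α = 1`,
  i.e. `γ = ½`, the power-like decay `|v| ∼ |y|⁻¹`, `|∇v| ∼ |y|⁻²` of He's exterior-domain
  profiles — the decay class below); at the Leray scaling `γ = ½`
  it is the class `𝓔_½` of route AffineBernoulli: `isDecayingSelfSimilarEulerProfile_half_iff`
  rewrites it to the five clauses of `EulerLerayLiouville` — `½U + DU(½(y−c) + U) + ∇P = 0`,
  `|U(y)| ≤ C(1+|y|)⁻¹`, `‖DU(y)‖ ≤ C((1+|y|)²)⁻¹` — and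
  `forall_isDecayingSelfSimilarEulerProfile_half_imp_iff` is the curried form of that rewriting.
  API: `isDecayingSelfSimilarEulerProfile_iff` (`= IsSelfSimilarEulerProfile ∧ decay`), the
  projections, the trivial member `.zero`, and on `ℝ³` the vorticity decay
  `|curl U(y)| ≤ C'(1+|y|)^{−1/γ}` (`.curl_decay`) and the vorticity form (3.4)
  (`.isSelfSimilarEulerVorticityProfile`; in the routes' commutator form
  `D(curl U)[V] − DU[curl U] = −curl U`, `.vorticity_eq_sub_form`, also for the PDE predicates).
  `isSelfSimilarEulerProfile_half_iff` is the `γ = ½` rewriting of the PDE predicate alone.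
* **The Bernoulli form of the profile equation (CIV (3.29))**, for the PDE predicate
  `IsSelfSimilarEulerProfile` (no decay involved): on any finite-dimensional inner product space
  the derivative of `ℋ` (`fderiv_selfSimilarBernoulli_apply`) and the pointwise identity
  `⟪(1−γ)U + DU V + ∇P, v⟫ = (1−2γ)⟪V, v⟫ + (⟪v, DU V⟫ − ⟪V, DU v⟫) + ⟪∇ℋ, v⟫`
  (`inner_profileResidual_eq`), valid for any `U`, `P` differentiable at the point; on `ℝ³`, where
  `⟪v, DU V⟫ − ⟪V, DU v⟫ = ⟪curl U × V, v⟫` (`inner_cross_curl_left`), the vector identity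
  `(1−γ)U + DU V + ∇P = (1−2γ)V + Ω × V + ∇ℋ` (`profileResidual_eq_bernoulliForm`, CIV §3.4.3:
  "we rewrite the first three terms as …"), hence **(3.3) ⇔ (3.29)**
  (`isSelfSimilarEulerProfile_iff_bernoulliForm`) and, for a profile,
  `(1−2γ)V + Ω × V + ∇ℋ = 0` (`IsSelfSimilarEulerProfile.bernoulliForm`),
  `∇ℋ = (2γ−1)V − Ω × V` (`.gradient_selfSimilarBernoulli`); at `γ = ½`, `∇ℋ = −Ω × V` with
  `ℋ = ½|½(y−c) + U|² + P − ⅛|y−c|²` (`selfSimilarBernoulli_half`,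
  `.gradient_selfSimilarBernoulli_half`) — identity (B) of route item `AffineBernoulliIdentities`.

## Mathlib / tree search

`lean search 'SelfSimilarEuler|selfSimilarBernoulli|similarityField'`: the CIV vocabulary of the
first request (above; reused, nothing redefined). `lean search 'cross.*curl|spin'`: the Lamb form
`convect_self_eq_cross_curl_add_gradient` (`LambFormCurlKernel.lean`, the case `V = U`) and
`inner_cross_curl` (`LagrangianTimeDerivativeTools.lean`, `⟪a × b, curl ψ⟫`) live in files with a
heavy Biot–Savart import cone; the three-line coordinate identity needed here is proved directly.
Mathlib: `gradient`, `inner_gradient_left`, `HasFDerivAt.norm_sq`, `crossProduct` (`cross_apply`).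

## Design notes

* The new predicate is a plain `def … : Prop := _ ∧ _ ∧ _ ∧ _ ∧ ∃ C, ∀ y, _ ∧ _` with the
  clauses in the routes' order, so that at `γ = ½` only the numerals differ from the inlined text
  (`1 − ½ = ½`, `(1+|y|)^{1−2} = (1+|y|)⁻¹`, `(1+|y|)^{−2} = ((1+|y|)²)⁻¹`, real vs. natural powers):
  `isDecayingSelfSimilarEulerProfile_half_iff` is that arithmetic and nothing else.
* The decay is NOT CIV's (3.8) verbatim: (3.8) reads `|U(y)| ≤ C|y − c|⟨y − c⟩^{−1/γ}` (forcing
  `U(c) = 0`, CIV's Galilean normalisation (3.5)) with `⟨z⟩ = (1+|z|²)^{1/2}`; the routes use the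
  bracket `1 + |y|` about the origin and do not pin `U(c)`. Same rates, different bookkeeping; the
  tree keeps both (`HasSelfSimilarFarFieldWith` for (3.8)).
* Stated on a finite-dimensional real inner product space `E` where nothing is specific to `ℝ³`
  (the predicate, the `γ = ½` rewriting, the derivative of `ℋ`, the weak identity); the cross
  product form and the vorticity need `ℝ³ = EuclideanSpace ℝ (Fin 3)`.
* No named facts are introduced (all statements are definitions or proved theorems).

## References

* P. Constantin, M. Ignatova, V. Vicol, *On putative self-similarity for incompressible 3D Euler*,
  arXiv:2602.17570 (2026), §3.1.1 eqs. (3.2)–(3.3), §3.1.3 eq. (3.8), §3.4 (3.19), §3.4.3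
  (3.29)–(3.31) [ConstantinIgnatovaVicol2026Putative].
* D. Chae, R. Shvydkoy, *On formation of a locally self-similar collapse in the incompressible
  Euler equations*, ARMA 209 (2013), §1 (the locally self-similar ansatz with exponent `α > −1`
  and the decay `|v| ∼ |y|⁻¹`, `|∇v| ∼ |y|⁻²` at `α = 1`) [ChaeShvydkoy2013].
* A. J. Majda, A. L. Bertozzi, *Vorticity and Incompressible Flow* (CUP 2002), §1.4 eqs.
  (1.19)–(1.21) (`Ω = ½(∇v − ∇vᵗ)`, `Ωh = ½ω × h`) [MajdaBertozziCUP2002].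
-/

noncomputable section

open Set InnerProductSpace
open scoped RealInnerProductSpace

namespace Literature.Analysis.FluidPDE

/-! ### The route class: profile equation plus power-law far field -/

section General

variable {E : Type*} [NormedAddCommGroup E] [InnerProductSpace ℝ E] [FiniteDimensional ℝ E]

/-- **Self-similar Euler profile with power-law far field** (the class `𝓔_γ` the routes
AffineBernoulli / VortexLineClock quantify over): `U ∈ C²`, `P ∈ C¹`, `div U = 0`, the stationary
self-similar Euler equation `(1−γ)U(y) + DU(y)[γ(y−c) + U(y)] + ∇P(y) = 0` for all `y`
(Constantin–Ignatova–Vicol (3.3), exponent `γ`, centre `c`), and the far-field rates of CIV (3.8)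
in the bracket `1 + |y|`: for some constant `C`, `|U(y)| ≤ C(1+|y|)^{1−1/γ}` and
`‖DU(y)‖ ≤ C(1+|y|)^{−1/γ}` (operator norm, real powers). This is the class of profiles of the
ansatz (3.2) `u(x,t) = (T−t)^{γ−1}U((x−x_*)/(T−t)^γ)` with the decay dictated by the kernels of
`(1−γ) + γ y·∇` and `1 + γ y·∇` (CIV §3.1.3); unlike (3.8) it does not impose `U(c) = 0`. The PDE
part alone is `IsSelfSimilarEulerProfile` (`isDecayingSelfSimilarEulerProfile_iff`); at `γ = ½`
see `isDecayingSelfSimilarEulerProfile_half_iff`. [cite: ConstantinIgnatovaVicol2026Putative, §3.1.1 eq. (3.3) and §3.1.3 eq. (3.8)] -/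
def IsDecayingSelfSimilarEulerProfile (γ : ℝ) (c : E) (U : E → E) (P : E → ℝ) : Prop :=
  ContDiff ℝ 2 U ∧ ContDiff ℝ 1 P ∧ VectorCalculus.IsDivFree U ∧
    (∀ y, (1 - γ) • U y + fderiv ℝ U y (γ • (y - c) + U y) + gradient P y = 0) ∧
    ∃ C : ℝ, ∀ y, ‖U y‖ ≤ C * (1 + ‖y‖) ^ (1 - 1 / γ) ∧ ‖fderiv ℝ U y‖ ≤ C * (1 + ‖y‖) ^ (-(1 / γ))

/-- `𝓔_γ` = the profile equation (3.3) (`IsSelfSimilarEulerProfile`) plus the power-law far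
field. [cite: ConstantinIgnatovaVicol2026Putative, §3.1.1 eq. (3.3) and §3.1.3 eq. (3.8)] -/
theorem isDecayingSelfSimilarEulerProfile_iff {γ : ℝ} {c : E} {U : E → E} {P : E → ℝ} :
    IsDecayingSelfSimilarEulerProfile γ c U P ↔
      IsSelfSimilarEulerProfile γ c U P ∧
        ∃ C : ℝ, ∀ y, ‖U y‖ ≤ C * (1 + ‖y‖) ^ (1 - 1 / γ) ∧
          ‖fderiv ℝ U y‖ ≤ C * (1 + ‖y‖) ^ (-(1 / γ)) := by
  constructor
  · rintro ⟨hU, hP, hdiv, heq, hdec⟩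
    exact ⟨⟨hU, hP, heq, hdiv⟩, hdec⟩
  · rintro ⟨⟨hU, hP, heq, hdiv⟩, hdec⟩
    exact ⟨hU, hP, hdiv, heq, hdec⟩

/-- A solution of the profile equation with the power-law far field is in the class `𝓔_γ`.
[cite: ConstantinIgnatovaVicol2026Putative, §3.1.1 eq. (3.3) and §3.1.3 eq. (3.8)] -/
theorem IsSelfSimilarEulerProfile.isDecayingSelfSimilarEulerProfile {γ : ℝ} {c : E} {U : E → E}
    {P : E → ℝ} (h : IsSelfSimilarEulerProfile γ c U P)
    (hdec : ∃ C : ℝ, ∀ y, ‖U y‖ ≤ C * (1 + ‖y‖) ^ (1 - 1 / γ) ∧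
      ‖fderiv ℝ U y‖ ≤ C * (1 + ‖y‖) ^ (-(1 / γ))) :
    IsDecayingSelfSimilarEulerProfile γ c U P :=
  isDecayingSelfSimilarEulerProfile_iff.2 ⟨h, hdec⟩

namespace IsDecayingSelfSimilarEulerProfile

variable {γ : ℝ} {c : E} {U : E → E} {P : E → ℝ}

/-- The PDE part: a member of `𝓔_γ` solves (3.3). [cite: ConstantinIgnatovaVicol2026Putative, §3.1.1 eq. (3.3)] -/
theorem isSelfSimilarEulerProfile (h : IsDecayingSelfSimilarEulerProfile γ c U P) :
    IsSelfSimilarEulerProfile γ c U P :=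
  (isDecayingSelfSimilarEulerProfile_iff.1 h).1

/-- The far-field part: `|U(y)| ≤ C(1+|y|)^{1−1/γ}`, `‖DU(y)‖ ≤ C(1+|y|)^{−1/γ}`. [cite: ConstantinIgnatovaVicol2026Putative, §3.1.3 eq. (3.8)] -/
theorem decay (h : IsDecayingSelfSimilarEulerProfile γ c U P) :
    ∃ C : ℝ, ∀ y, ‖U y‖ ≤ C * (1 + ‖y‖) ^ (1 - 1 / γ) ∧
      ‖fderiv ℝ U y‖ ≤ C * (1 + ‖y‖) ^ (-(1 / γ)) :=
  (isDecayingSelfSimilarEulerProfile_iff.1 h).2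

/-- The far-field constant may be taken nonnegative. [cite: ConstantinIgnatovaVicol2026Putative, §3.1.3 eq. (3.8)] -/
theorem decay_nonneg (h : IsDecayingSelfSimilarEulerProfile γ c U P) :
    ∃ C : ℝ, 0 ≤ C ∧ ∀ y, ‖U y‖ ≤ C * (1 + ‖y‖) ^ (1 - 1 / γ) ∧
      ‖fderiv ℝ U y‖ ≤ C * (1 + ‖y‖) ^ (-(1 / γ)) := by
  obtain ⟨C, hC⟩ := h.decay
  refine ⟨max C 0, le_max_right _ _, fun y => ⟨?_, ?_⟩⟩
  · exact le_trans (hC y).1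
      (mul_le_mul_of_nonneg_right (le_max_left _ _) (Real.rpow_nonneg (by positivity) _))
  · exact le_trans (hC y).2
      (mul_le_mul_of_nonneg_right (le_max_left _ _) (Real.rpow_nonneg (by positivity) _))

/-- `U ∈ C²`. [cite: ConstantinIgnatovaVicol2026Putative, §3.1.1 eq. (3.3)] -/
theorem contDiff_velocity (h : IsDecayingSelfSimilarEulerProfile γ c U P) : ContDiff ℝ 2 U := h.1

/-- `P ∈ C¹`. [cite: ConstantinIgnatovaVicol2026Putative, §3.1.1 eq. (3.3)] -/
theorem contDiff_pressure (h : IsDecayingSelfSimilarEulerProfile γ c U P) : ContDiff ℝ 1 P := h.2.1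

/-- `div U = 0`. [cite: ConstantinIgnatovaVicol2026Putative, §3.1.1 eq. (3.3)] -/
theorem divFree (h : IsDecayingSelfSimilarEulerProfile γ c U P) : VectorCalculus.IsDivFree U :=
  h.2.2.1

/-- The profile equation `(1−γ)U + DU[γ(y−c) + U] + ∇P = 0`. [cite: ConstantinIgnatovaVicol2026Putative, §3.1.1 eq. (3.3)] -/
theorem profile_eq (h : IsDecayingSelfSimilarEulerProfile γ c U P) (y : E) :
    (1 - γ) • U y + fderiv ℝ U y (γ • (y - c) + U y) + gradient P y = 0 :=
  h.2.2.2.1 y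

/-- `U` is differentiable. [cite: ConstantinIgnatovaVicol2026Putative, §3.1.1 eq. (3.3)] -/
theorem differentiable_velocity (h : IsDecayingSelfSimilarEulerProfile γ c U P) :
    Differentiable ℝ U :=
  h.isSelfSimilarEulerProfile.differentiable_velocity

/-- The trivial member `U = 0`, `P = 0` (constant `C = 0`). [folklore] -/
protected theorem zero (γ : ℝ) (c : E) :
    IsDecayingSelfSimilarEulerProfile γ c (0 : E → E) (0 : E → ℝ) :=
  (IsSelfSimilarEulerProfile.zero γ c).isDecayingSelfSimilarEulerProfile
    ⟨0, fun y => by simp [Pi.zero_def]⟩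

end IsDecayingSelfSimilarEulerProfile

/-! ### The Leray scaling `γ = ½` -/

omit [InnerProductSpace ℝ E] [FiniteDimensional ℝ E] in
/-- `(1+|y|)^{−2} = ((1+|y|)²)⁻¹` (real versus natural power). [folklore] -/
theorem one_add_norm_rpow_neg_two {F : Type*} [NormedAddCommGroup F] (y : F) :
    (1 + ‖y‖) ^ (-2 : ℝ) = ((1 + ‖y‖) ^ 2)⁻¹ := by
  rw [Real.rpow_neg (by positivity), Real.rpow_two]

/-- **The profile equation at the Leray scaling `γ = ½`** in the routes' form: `U ∈ C²`, `P ∈ C¹`,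
`div U = 0` and `½U(y) + DU(y)[½(y−c) + U(y)] + ∇P(y) = 0` (the four PDE clauses of
`AffineBernoulliIdentities` / `EulerLerayLiouville`; only `1 − ½ = ½` is rewritten).
[cite: ConstantinIgnatovaVicol2026Putative, §3.1.1 eq. (3.3) at γ = 1/2] -/
theorem isSelfSimilarEulerProfile_half_iff {c : E} {U : E → E} {P : E → ℝ} :
    IsSelfSimilarEulerProfile (1 / 2) c U P ↔
      ContDiff ℝ 2 U ∧ ContDiff ℝ 1 P ∧ VectorCalculus.IsDivFree U ∧
        ∀ y, (1 / 2 : ℝ) • U y + fderiv ℝ U y ((1 / 2 : ℝ) • (y - c) + U y) + gradient P y = 0 := by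
  have h1 : (1 : ℝ) - 1 / 2 = 1 / 2 := by norm_num
  constructor
  · rintro ⟨hU, hP, heq, hdiv⟩
    exact ⟨hU, hP, hdiv, fun y => by have e := heq y; rw [h1] at e; exact e⟩
  · rintro ⟨hU, hP, hdiv, heq⟩
    exact ⟨hU, hP, fun y => by rw [h1]; exact heq y, hdiv⟩

/-- **`𝓔_½` is the class of route AffineBernoulli.** At the Leray scaling `γ = ½` the predicate
unfolds to the five clauses inlined in `EulerLerayLiouville` / `AlignedStratumTrivial` (the
first four also in `AffineBernoulliIdentities`): `U ∈ C²`, `P ∈ C¹`, `div U = 0`,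
`½U(y) + DU(y)[½(y−c) + U(y)] + ∇P(y) = 0`, and `|U(y)| ≤ C(1+|y|)⁻¹`, `‖DU(y)‖ ≤ C((1+|y|)²)⁻¹`
(only numerals are rewritten: `1 − ½ = ½`, `(1+|y|)^{1−2} = (1+|y|)⁻¹`, `(1+|y|)^{−2} = ((1+|y|)²)⁻¹`).
[cite: ConstantinIgnatovaVicol2026Putative, §3.1.1 eq. (3.3) and §3.1.3 eq. (3.8) at γ = 1/2] -/
theorem isDecayingSelfSimilarEulerProfile_half_iff {c : E} {U : E → E} {P : E → ℝ} :
    IsDecayingSelfSimilarEulerProfile (1 / 2) c U P ↔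
      ContDiff ℝ 2 U ∧ ContDiff ℝ 1 P ∧ VectorCalculus.IsDivFree U ∧
        (∀ y, (1 / 2 : ℝ) • U y + fderiv ℝ U y ((1 / 2 : ℝ) • (y - c) + U y) + gradient P y = 0) ∧
        ∃ C : ℝ, ∀ y, ‖U y‖ ≤ C * (1 + ‖y‖)⁻¹ ∧ ‖fderiv ℝ U y‖ ≤ C * ((1 + ‖y‖) ^ 2)⁻¹ := by
  have h1 : (1 : ℝ) - 1 / 2 = 1 / 2 := by norm_num
  have h2 : (1 : ℝ) - 1 / (1 / 2) = -1 := by norm_num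
  have h3 : -(1 / (1 / 2) : ℝ) = -2 := by norm_num
  simp only [IsDecayingSelfSimilarEulerProfile, h1, h2, h3, Real.rpow_neg_one,
    one_add_norm_rpow_neg_two]

/-- **Curried form of `isDecayingSelfSimilarEulerProfile_half_iff`**: a statement
"for all `(c, U, P) ∈ 𝓔_½`, `Q`" is the same as the statement with the five clauses as separate
hypotheses, in the routes' order (with `Q c U P := ∀ y, U y = 0` the right-hand side is literally
route AffineBernoulli's `EulerLerayLiouville`). [cite: ConstantinIgnatovaVicol2026Putative, §3.1.1 eq. (3.3) and §3.1.3 eq. (3.8) at γ = 1/2] -/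
theorem forall_isDecayingSelfSimilarEulerProfile_half_imp_iff (Q : E → (E → E) → (E → ℝ) → Prop) :
    (∀ c U P, IsDecayingSelfSimilarEulerProfile (1 / 2) c U P → Q c U P) ↔
      ∀ (c : E) (U : E → E) (P : E → ℝ), ContDiff ℝ 2 U → ContDiff ℝ 1 P →
        VectorCalculus.IsDivFree U →
        (∀ y, (1 / 2 : ℝ) • U y + fderiv ℝ U y ((1 / 2 : ℝ) • (y - c) + U y) + gradient P y = 0) →
        (∃ C : ℝ, ∀ y, ‖U y‖ ≤ C * (1 + ‖y‖)⁻¹ ∧ ‖fderiv ℝ U y‖ ≤ C * ((1 + ‖y‖) ^ 2)⁻¹) →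
        Q c U P := by
  simp only [isDecayingSelfSimilarEulerProfile_half_iff, and_imp]

/-- The Liouville statement for `𝓔_½` in both forms: "every `(c, U, P) ∈ 𝓔_½` has `U ≡ 0`" iff
the curried five-clause statement (route AffineBernoulli's `EulerLerayLiouville`, on `E = ℝ³`).
[cite: ConstantinIgnatovaVicol2026Putative, §3.1.1 eq. (3.3) and §3.1.3 eq. (3.8) at γ = 1/2] -/
theorem forall_isDecayingSelfSimilarEulerProfile_half_eq_zero_iff :
    (∀ (c : E) (U : E → E) (P : E → ℝ),
        IsDecayingSelfSimilarEulerProfile (1 / 2) c U P → ∀ y, U y = 0) ↔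
      ∀ (c : E) (U : E → E) (P : E → ℝ), ContDiff ℝ 2 U → ContDiff ℝ 1 P →
        VectorCalculus.IsDivFree U →
        (∀ y, (1 / 2 : ℝ) • U y + fderiv ℝ U y ((1 / 2 : ℝ) • (y - c) + U y) + gradient P y = 0) →
        (∃ C : ℝ, ∀ y, ‖U y‖ ≤ C * (1 + ‖y‖)⁻¹ ∧ ‖fderiv ℝ U y‖ ≤ C * ((1 + ‖y‖) ^ 2)⁻¹) →
        ∀ y, U y = 0 :=
  forall_isDecayingSelfSimilarEulerProfile_half_imp_iff fun _ U _ => ∀ y, U y = 0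

omit [FiniteDimensional ℝ E] in
/-- At `γ = ½` the self-similar Bernoulli function is `ℋ(z) = ½|½(z−c) + U(z)|² + P(z) − ⅛|z−c|²`
(CIV (3.30) with `γ(γ−1)/2 = −⅛`; the form written in route item `AffineBernoulliIdentities`).
[cite: ConstantinIgnatovaVicol2026Putative, §3.4.3 eq. (3.30) at γ = 1/2] -/
theorem selfSimilarBernoulli_half (c : E) (U : E → E) (P : E → ℝ) :
    selfSimilarBernoulli (1 / 2) c U P = fun z =>
      (1 / 2 : ℝ) * ‖(1 / 2 : ℝ) • (z - c) + U z‖ ^ 2 + P z - (1 / 8 : ℝ) * ‖z - c‖ ^ 2 := by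
  funext z
  rw [selfSimilarBernoulli_apply]
  ring

/-! ### The derivative of the Bernoulli function and the weak form of (3.29) -/

omit [FiniteDimensional ℝ E] in
/-- **The derivative of the self-similar Bernoulli function** `ℋ = ½|V|² + P + ½γ(γ−1)|y−c|²`,
`V = γ(y−c) + U`: `Dℋ(y)[v] = ⟪V(y), γv + DU(y)v⟫ + DP(y)[v] + γ(γ−1)⟪y − c, v⟫`, for `U`, `P`
differentiable at `y`. [cite: ConstantinIgnatovaVicol2026Putative, §3.4.3 eq. (3.30)] -/
theorem hasFDerivAt_selfSimilarBernoulli {γ : ℝ} {c : E} {U : E → E} {P : E → ℝ} {y : E}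
    (hU : DifferentiableAt ℝ U y) (hP : DifferentiableAt ℝ P y) :
    HasFDerivAt (selfSimilarBernoulli γ c U P)
      ((1 / 2 : ℝ) • (2 • (innerSL ℝ (γ • (y - c) + U y)).comp
          (γ • ContinuousLinearMap.id ℝ E + fderiv ℝ U y)) + fderiv ℝ P y +
        (γ * (γ - 1) / 2) • (2 • (innerSL ℝ (y - c)).comp (ContinuousLinearMap.id ℝ E))) y := by
  have hV : HasFDerivAt (fun z => γ • (z - c) + U z)
      (γ • ContinuousLinearMap.id ℝ E + fderiv ℝ U y) y :=
    (((hasFDerivAt_id y).sub_const c).fun_const_smul γ).fun_add hU.hasFDerivAt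
  have hsq : HasFDerivAt (fun z : E => ‖z - c‖ ^ 2)
      (2 • (innerSL ℝ (y - c)).comp (ContinuousLinearMap.id ℝ E)) y :=
    ((hasFDerivAt_id y).sub_const c).norm_sq
  have e := ((hV.norm_sq.const_smul (1 / 2 : ℝ)).fun_add hP.hasFDerivAt).fun_add
    (hsq.const_smul (γ * (γ - 1) / 2))
  refine e.congr_of_eventuallyEq (Filter.Eventually.of_forall fun z => ?_)
  simp only [selfSimilarBernoulli_apply, Pi.smul_apply, smul_eq_mul]

omit [FiniteDimensional ℝ E] in
/-- `Dℋ(y)[v] = ⟪V(y), γv + DU(y)v⟫ + DP(y)[v] + γ(γ−1)⟪y − c, v⟫` (`V = γ(y−c) + U`), for `U`,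
`P` differentiable at `y`. [cite: ConstantinIgnatovaVicol2026Putative, §3.4.3 eq. (3.30)] -/
theorem fderiv_selfSimilarBernoulli_apply {γ : ℝ} {c : E} {U : E → E} {P : E → ℝ} {y : E}
    (hU : DifferentiableAt ℝ U y) (hP : DifferentiableAt ℝ P y) (v : E) :
    fderiv ℝ (selfSimilarBernoulli γ c U P) y v =
      ⟪γ • (y - c) + U y, γ • v + fderiv ℝ U y v⟫ + fderiv ℝ P y v + γ * (γ - 1) * ⟪y - c, v⟫ := by
  rw [(hasFDerivAt_selfSimilarBernoulli hU hP).fderiv]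
  simp only [_root_.add_apply, _root_.smul_apply, two_nsmul, ContinuousLinearMap.comp_apply,
    ContinuousLinearMap.id_apply, innerSL_apply_apply, smul_eq_mul]
  ring

/-- **CIV §3.4.3, the rewriting behind (3.29), in weak form on any inner product space**: for
`U`, `P` differentiable at `y`, with `V = γ(y−c) + U(y)` and `ℋ` the self-similar Bernoulli
function, for every `v`,
`⟪(1−γ)U + DU V + ∇P, v⟫ = (1−2γ)⟪V, v⟫ + (⟪v, DU V⟫ − ⟪V, DU v⟫) + ⟪∇ℋ, v⟫`
(the middle term is `⟪(DU − DUᵀ)V, v⟫ = ⟪curl U × V, v⟫` on `ℝ³`, `inner_cross_curl_left`). No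
equation is used: this is the pointwise algebra "`(1−γ)U + (γy + U)·∇U = −γ(1−γ)∇½|y|² + (1−2γ)V
+ Ω × V + ∇½|V|²`". [cite: ConstantinIgnatovaVicol2026Putative, §3.4.3 eq. (3.29) (derivation)] -/
theorem inner_profileResidual_eq {γ : ℝ} {c : E} {U : E → E} {P : E → ℝ} {y : E}
    (hU : DifferentiableAt ℝ U y) (hP : DifferentiableAt ℝ P y) (v : E) :
    ⟪(1 - γ) • U y + fderiv ℝ U y (γ • (y - c) + U y) + gradient P y, v⟫ =
      (1 - 2 * γ) * ⟪γ • (y - c) + U y, v⟫ +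
        (⟪v, fderiv ℝ U y (γ • (y - c) + U y)⟫ - ⟪γ • (y - c) + U y, fderiv ℝ U y v⟫) +
        ⟪gradient (selfSimilarBernoulli γ c U P) y, v⟫ := by
  rw [inner_gradient_left, fderiv_selfSimilarBernoulli_apply hU hP v]
  simp only [inner_add_left, inner_smul_left, inner_add_right, inner_smul_right, conj_trivial,
    inner_gradient_left]
  rw [real_inner_comm v (fderiv ℝ U y (γ • (y - c) + U y))]
  ring

/-- **(3.29) in weak form for a profile**: if `(U, P)` solves (3.3) then for every `y`, `v`,
`⟪∇ℋ(y), v⟫ = (2γ−1)⟪V, v⟫ + (⟪V, DU v⟫ − ⟪v, DU V⟫)`, i.e. `∇ℋ = (2γ−1)V − (DU − DUᵀ)V`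
(`= (2γ−1)V − Ω × V` on `ℝ³`). Taking `v = V` recovers the transport identity (3.31)
`V·∇ℋ = (2γ−1)|V|²` (`IsSelfSimilarEulerProfile.fderiv_selfSimilarBernoulli_transport`).
[cite: ConstantinIgnatovaVicol2026Putative, §3.4.3 eq. (3.29)] -/
theorem IsSelfSimilarEulerProfile.inner_gradient_selfSimilarBernoulli {γ : ℝ} {c : E} {U : E → E}
    {P : E → ℝ} (h : IsSelfSimilarEulerProfile γ c U P) (y v : E) :
    ⟪gradient (selfSimilarBernoulli γ c U P) y, v⟫ =
      (2 * γ - 1) * ⟪selfSimilarTransport γ c U y, v⟫ +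
        (⟪selfSimilarTransport γ c U y, fderiv ℝ U y v⟫ -
          ⟪v, fderiv ℝ U y (selfSimilarTransport γ c U y)⟫) := by
  have e := inner_profileResidual_eq (γ := γ) (c := c) (h.differentiable_velocity y)
    (h.differentiable_pressure y) v
  rw [h.profile_eq y, inner_zero_left] at e
  rw [selfSimilarTransport_apply]
  linarith

end General

/-! ### Three dimensions: the cross-product form (3.29), vorticity decay -/

section SpaceDimThree

/-- Expansion of a linear map of `ℝ³` along the standard basis: `L v = ∑ₘ vₘ L eₘ`. [folklore] -/
private theorem clm_apply_eq_sum_smul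
    (L : EuclideanSpace ℝ (Fin 3) →L[ℝ] EuclideanSpace ℝ (Fin 3)) (v : EuclideanSpace ℝ (Fin 3)) :
    L v = ∑ m, v m • L (EuclideanSpace.single m (1 : ℝ)) := by
  have hv : v = ∑ m, v m • EuclideanSpace.single m (1 : ℝ) := by
    simpa using ((EuclideanSpace.basisFun (Fin 3) ℝ).sum_repr v).symm
  conv_lhs => rw [hv]
  simp [map_sum, map_smul]

/-- **The antisymmetric part of the velocity gradient is the cross product with the vorticity**
(Majda–Bertozzi, §1.4, (1.19)–(1.21): `Ω = ½(∇v − ∇vᵗ)` satisfies `Ωh = ½ω × h`), in the weak form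
used here: for any field `U` and vectors `a`, `b`, `⟪curl U(y) × a, b⟫ = ⟪b, DU(y) a⟫ − ⟪a, DU(y) b⟫`
(pure linear algebra in the entries of `DU(y)`). [cite: MajdaBertozziCUP2002, §1.4 eqs. (1.19)–(1.21)] -/
theorem inner_cross_curl_left (U : EuclideanSpace ℝ (Fin 3) → EuclideanSpace ℝ (Fin 3))
    (y a b : EuclideanSpace ℝ (Fin 3)) :
    ⟪cross (curl U y) a, b⟫ = ⟪b, fderiv ℝ U y a⟫ - ⟪a, fderiv ℝ U y b⟫ := by
  rw [clm_apply_eq_sum_smul (fderiv ℝ U y) a, clm_apply_eq_sum_smul (fderiv ℝ U y) b]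
  simp only [PiLp.inner_apply, RCLike.inner_apply, conj_trivial, Fin.sum_univ_three,
    PiLp.add_apply, PiLp.smul_apply, smul_eq_mul]
  simp [cross, cross_apply, curl]
  ring

variable {γ : ℝ} {c : EuclideanSpace ℝ (Fin 3)}
variable {U : EuclideanSpace ℝ (Fin 3) → EuclideanSpace ℝ (Fin 3)} {P : EuclideanSpace ℝ (Fin 3) → ℝ}

/-- **CIV §3.4.3: "in (3.3) we rewrite the first three terms"** — the pointwise vector identity
`(1−γ)U + DU V + ∇P = (1−2γ)V + (curl U) × V + ∇ℋ` on `ℝ³`, `V = γ(y−c) + U`,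
`ℋ = ½|V|² + P + ½γ(γ−1)|y−c|²`, for `U`, `P` differentiable at `y` (from the weak form
`inner_profileResidual_eq` and `inner_cross_curl_left`). [cite: ConstantinIgnatovaVicol2026Putative, §3.4.3 eq. (3.29) (derivation)] -/
theorem profileResidual_eq_bernoulliForm {y : EuclideanSpace ℝ (Fin 3)} (hU : DifferentiableAt ℝ U y)
    (hP : DifferentiableAt ℝ P y) :
    (1 - γ) • U y + fderiv ℝ U y (γ • (y - c) + U y) + gradient P y =
      (1 - 2 * γ) • (γ • (y - c) + U y) + cross (curl U y) (γ • (y - c) + U y) +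
        gradient (selfSimilarBernoulli γ c U P) y := by
  refine ext_inner_right ℝ fun v => ?_
  rw [inner_profileResidual_eq hU hP v]
  simp only [inner_add_left, inner_smul_left, inner_cross_curl_left, conj_trivial]

/-- **(3.3) ⇔ (3.29)** (CIV: "we obtain that (3.3) is equivalent to (3.29)"): for `U ∈ C²`,
`P ∈ C¹`, `div U = 0` on `ℝ³`, `(U, P)` is a self-similar Euler profile iff
`(1−2γ)V + (curl U) × V + ∇ℋ = 0` pointwise. [cite: ConstantinIgnatovaVicol2026Putative, §3.4.3 eq. (3.29)] -/
theorem isSelfSimilarEulerProfile_iff_bernoulliForm (hU : ContDiff ℝ 2 U) (hP : ContDiff ℝ 1 P)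
    (hdiv : VectorCalculus.IsDivFree U) :
    IsSelfSimilarEulerProfile γ c U P ↔
      ∀ y, (1 - 2 * γ) • selfSimilarTransport γ c U y +
          cross (curl U y) (selfSimilarTransport γ c U y) +
        gradient (selfSimilarBernoulli γ c U P) y = 0 := by
  have hUd : Differentiable ℝ U := hU.differentiable (by norm_num)
  have hPd : Differentiable ℝ P := hP.differentiable one_ne_zero
  constructor
  · intro h y
    rw [selfSimilarTransport_apply, ← profileResidual_eq_bernoulliForm (hUd y) (hPd y)]
    exact h.profile_eq y
  · intro h
    exact ⟨hU, hP, fun y => by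
      rw [profileResidual_eq_bernoulliForm (hUd y) (hPd y)]
      exact h y, hdiv⟩

/-- **The vorticity equation (3.4) in commutator form**, as inlined by the routes: for a
vorticity-form profile, `D(curl U)(y)[γ(y−c) + U(y)] − DU(y)[curl U(y)] = −curl U(y)`, i.e.
`(V·∇)Ω − (Ω·∇)U = −Ω` (equivalently `[V, Ω] = −(1+γ)Ω` with `DV = γI + DU`,
`IsSelfSimilarEulerVorticityProfile.fderiv_curl_transport_sub_fderiv_transport_curl`).
[cite: ConstantinIgnatovaVicol2026Putative, §3.1.1 eq. (3.4)] -/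
theorem IsSelfSimilarEulerVorticityProfile.vorticity_eq_sub_form
    (h : IsSelfSimilarEulerVorticityProfile γ c U) (y : EuclideanSpace ℝ (Fin 3)) :
    fderiv ℝ (curl U) y (γ • (y - c) + U y) - fderiv ℝ U y (curl U y) = -curl U y := by
  have e := h.vorticity_eq y
  rw [← sub_eq_zero, ← sub_eq_zero.2 e]
  abel

namespace IsSelfSimilarEulerProfile

/-- **(3.3) ⇒ (3.4) in commutator form**: for a self-similar Euler profile on `ℝ³`,
`D(curl U)(y)[γ(y−c) + U(y)] − DU(y)[curl U(y)] = −curl U(y)` (the curl of (3.3),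
`IsSelfSimilarEulerProfile.isSelfSimilarEulerVorticityProfile`; at `γ = ½` this is identity (C) of
route item `AffineBernoulliIdentities`, no decay used). [cite: ConstantinIgnatovaVicol2026Putative, §3.1.1 eqs. (3.3)–(3.4)] -/
theorem vorticity_eq_sub_form (h : IsSelfSimilarEulerProfile γ c U P) (y : EuclideanSpace ℝ (Fin 3)) :
    fderiv ℝ (curl U) y (γ • (y - c) + U y) - fderiv ℝ U y (curl U y) = -curl U y :=
  h.isSelfSimilarEulerVorticityProfile.vorticity_eq_sub_form y

/-- **The Bernoulli form of the profile equation (CIV (3.29))**: for a self-similar Euler profile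
on `ℝ³`, `(1−2γ)V + Ω × V + ∇ℋ = 0` pointwise, with `V = γ(y−c) + U` the transport field (3.19),
`Ω = curl U = curl V`, and `ℋ = ½|V|² + P + ½γ(γ−1)|y−c|²` the self-similar Bernoulli function
(3.30). [cite: ConstantinIgnatovaVicol2026Putative, §3.4.3 eq. (3.29)] -/
theorem bernoulliForm (h : IsSelfSimilarEulerProfile γ c U P) (y : EuclideanSpace ℝ (Fin 3)) :
    (1 - 2 * γ) • selfSimilarTransport γ c U y +
          cross (curl U y) (selfSimilarTransport γ c U y) +
        gradient (selfSimilarBernoulli γ c U P) y = 0 :=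
  (isSelfSimilarEulerProfile_iff_bernoulliForm h.contDiff_velocity h.contDiff_pressure
    h.divFree).1 h y

/-- (3.29) solved for the gradient: `∇ℋ = (2γ−1)V − Ω × V`. [cite: ConstantinIgnatovaVicol2026Putative, §3.4.3 eq. (3.29)] -/
theorem gradient_selfSimilarBernoulli (h : IsSelfSimilarEulerProfile γ c U P) (y : EuclideanSpace ℝ (Fin 3)) :
    gradient (selfSimilarBernoulli γ c U P) y =
      (2 * γ - 1) • selfSimilarTransport γ c U y -
        cross (curl U y) (selfSimilarTransport γ c U y) := by
  have e := h.bernoulliForm y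
  rw [← sub_eq_zero, ← e]
  module

/-- **At the Leray scaling `γ = ½`: `∇ℋ = −Ω × V`**, `V = ½(y−c) + U`,
`ℋ(z) = ½|½(z−c) + U(z)|² + P(z) − ⅛|z−c|²` — the Bernoulli surfaces are spanned by `V` and `Ω`
(identity (B) of route item `AffineBernoulliIdentities`; no decay is used). [cite: ConstantinIgnatovaVicol2026Putative, §3.4.3 eq. (3.29) at γ = 1/2] -/
theorem gradient_selfSimilarBernoulli_half {c : EuclideanSpace ℝ (Fin 3)}
    {U : EuclideanSpace ℝ (Fin 3) → EuclideanSpace ℝ (Fin 3)} {P : EuclideanSpace ℝ (Fin 3) → ℝ}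
    (h : IsSelfSimilarEulerProfile (1 / 2) c U P) (y : EuclideanSpace ℝ (Fin 3)) :
    gradient (fun z => (1 / 2 : ℝ) * ‖(1 / 2 : ℝ) • (z - c) + U z‖ ^ 2 + P z -
        (1 / 8 : ℝ) * ‖z - c‖ ^ 2) y =
      -cross (curl U y) ((1 / 2 : ℝ) • (y - c) + U y) := by
  rw [← selfSimilarBernoulli_half, h.gradient_selfSimilarBernoulli y, selfSimilarTransport_apply]
  norm_num

end IsSelfSimilarEulerProfile

namespace IsDecayingSelfSimilarEulerProfile

/-- A member of `𝓔_γ` on `ℝ³` is a vorticity-form profile (3.4) (via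
`IsSelfSimilarEulerProfile.isSelfSimilarEulerVorticityProfile`, the curl of (3.3)). [cite: ConstantinIgnatovaVicol2026Putative, §3.1.1 eqs. (3.3)–(3.4)] -/
theorem isSelfSimilarEulerVorticityProfile (h : IsDecayingSelfSimilarEulerProfile γ c U P) :
    IsSelfSimilarEulerVorticityProfile γ c U :=
  h.isSelfSimilarEulerProfile.isSelfSimilarEulerVorticityProfile

/-- (3.4) in commutator form for a member of `𝓔_γ`: `D(curl U)[V] − DU[curl U] = −curl U`.
[cite: ConstantinIgnatovaVicol2026Putative, §3.1.1 eq. (3.4)] -/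
theorem vorticity_eq_sub_form (h : IsDecayingSelfSimilarEulerProfile γ c U P) (y : EuclideanSpace ℝ (Fin 3)) :
    fderiv ℝ (curl U) y (γ • (y - c) + U y) - fderiv ℝ U y (curl U y) = -curl U y :=
  h.isSelfSimilarEulerProfile.vorticity_eq_sub_form y

/-- (3.29) for a member of `𝓔_γ`. [cite: ConstantinIgnatovaVicol2026Putative, §3.4.3 eq. (3.29)] -/
theorem bernoulliForm (h : IsDecayingSelfSimilarEulerProfile γ c U P) (y : EuclideanSpace ℝ (Fin 3)) :
    (1 - 2 * γ) • selfSimilarTransport γ c U y +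
          cross (curl U y) (selfSimilarTransport γ c U y) +
        gradient (selfSimilarBernoulli γ c U P) y = 0 :=
  h.isSelfSimilarEulerProfile.bernoulliForm y

/-- **Vorticity decay in `𝓔_γ`**: `|curl U(y)| ≤ C'(1+|y|)^{−1/γ}` together with
`|U(y)| ≤ C'(1+|y|)^{1−1/γ}` for one constant `C'` (the curl is a bounded linear function of the
Jacobian, `norm_curl_le`) — the far-field clauses in the form inlined by route VortexLineClock
(`TypeIIWindowCore` / `EmptyEulerWindow`, for `Ω = curl U`). [cite: ConstantinIgnatovaVicol2026Putative, §3.1.3 eq. (3.8)] -/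
theorem curl_decay (h : IsDecayingSelfSimilarEulerProfile γ c U P) :
    ∃ C : ℝ, ∀ y, ‖curl U y‖ ≤ C * (1 + ‖y‖) ^ (-(1 / γ)) ∧
      ‖U y‖ ≤ C * (1 + ‖y‖) ^ (1 - 1 / γ) := by
  obtain ⟨C, hC0, hC⟩ := h.decay_nonneg
  refine ⟨max 1 ‖curlCLM‖ * C, fun y => ⟨?_, ?_⟩⟩
  · have hb : 0 ≤ (1 + ‖y‖) ^ (-(1 / γ)) := Real.rpow_nonneg (by positivity) _
    calc ‖curl U y‖ ≤ ‖curlCLM‖ * ‖fderiv ℝ U y‖ := norm_curl_le U y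
      _ ≤ ‖curlCLM‖ * (C * (1 + ‖y‖) ^ (-(1 / γ))) :=
          mul_le_mul_of_nonneg_left (hC y).2 (ContinuousLinearMap.opNorm_nonneg curlCLM)
      _ ≤ max 1 ‖curlCLM‖ * (C * (1 + ‖y‖) ^ (-(1 / γ))) :=
          mul_le_mul_of_nonneg_right (le_max_right _ _) (mul_nonneg hC0 hb)
      _ = max 1 ‖curlCLM‖ * C * (1 + ‖y‖) ^ (-(1 / γ)) := by ring
  · have hb : 0 ≤ (1 + ‖y‖) ^ (1 - 1 / γ) := Real.rpow_nonneg (by positivity) _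
    calc ‖U y‖ ≤ C * (1 + ‖y‖) ^ (1 - 1 / γ) := (hC y).1
      _ = 1 * (C * (1 + ‖y‖) ^ (1 - 1 / γ)) := (one_mul _).symm
      _ ≤ max 1 ‖curlCLM‖ * (C * (1 + ‖y‖) ^ (1 - 1 / γ)) :=
          mul_le_mul_of_nonneg_right (le_max_left _ _) (mul_nonneg hC0 hb)
      _ = max 1 ‖curlCLM‖ * C * (1 + ‖y‖) ^ (1 - 1 / γ) := by ring

end IsDecayingSelfSimilarEulerProfile

end SpaceDimThree

end Literature.Analysis.FluidPDE
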